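import Summits.AtomisticToContinuum.BoseEinsteinCondensation.Theorems.BECInsertionCorrectorStaticResponseBoundFewBody5AllCouplingCore
import Summits.AtomisticToContinuum.BoseEinsteinCondensation.Theorems.BECInsertionCorrectorStaticResponseBoundFewBodyPerturbative
import HarnessLib

/-!
# The few-body half of the static response bound for EVERY coupling: second-order perturbation theory
# without a weak-coupling window — registered stub `stub_allCouplingPT` (line `stable-fraction-square-completion`,
# seat a1; item stmt-AtomisticToContinuum-12057 — this file supports, does not close, the item)

Setting (as in part I, `…FewBodyPerturbative`): `Φ > 0` a real `C¹` finite-energy MINIMISER of `E_w` among finite-energy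
periodic states (value `λ`), `F = |Φ|`, `μ = F²dX`, `V = ∑ⱼ cos(p·xⱼ)`, `p = 2πk/L`, `𝓔(θ) = ∫|∇θ|²dμ`; `θ = a + η`,
`a = ∫θdμ`, `m = ∫η²dμ`, `D = 𝓔(η) = 𝓔(θ)`, weighted gap `g m ≤ D` with `g = (2π/L)² − 2λ ≥ 3λ` (`5λ ≤ (2π/L)²`),
`T₀ = ∫|∇F|² ≤ λ`, sign `t⟨V⟩_Φ ≥ 0`.  NEW: the bound

  `𝓔(θ) + t∫Vθ²dμ ≥ −14 t²(N/|p|²)∫θ²dμ`   for EVERY `t ∈ ℝ`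

(part I needed `2|t|N ≤ g` and the mode-pairing bound; neither is used here).  Proof (files 1/3–2/3 of this series):
1. WEIGHTED completed square with drift `−(t/|p|²)∇V` against `μ` (`pt5_weightedSq_sum`, `κ = 1/4`):
   `D/4 + t∫Vθ²F² ≥ −(4t²N/|p|²)∫θ²F² − (2t/|p|²)∫B θ²F`, `B = ∑_{j,c}p_c sin(p·xⱼ)∂_{j,c}F`;
2. `∫B F = −(|p|²/2)⟨V⟩_Φ` (`pt5_meanFlux`), so the `a²`-part of the cross term is `+t a²⟨V⟩_Φ ≥ 0`;
   `|∫BηF| ≤ √m √(|p|²N T₀)`, `|∫Bη²F| ≤ √m √(|p|²N) Z`, `Z² = ∫η²|∇F|²` (`pt5_forceField_sq_le`, Cauchy–Schwarz);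
3. Euler–Lagrange for the minimiser tested against `η²F` (`pt5_eulerLagrange_sq_bound`): `Z² ≤ λm + 2√D·Z`;
4. `allCoupling_algebraic_core`.
Consequence (files …FewBody5Assembly/Window/Composition/WeakCoupling of the seat-a1 layer): the few-body regime is
`E₀·L² ≤ 4π²/5` (no factor `N`), i.e. the window `N⁵ρa³ ≤ c` at `L = (N/ρ)^{1/3}` (was `N⁸ρa³ ≤ c`).

References: [ReedSimonIV1978] §XII.2 (second-order perturbation theory, here variational and remainder-free);
[Davies1989] §4.2 (ground-state transform).
-/

noncomputable section

namespace Summit.AtomisticToContinuum.BoseEinsteinCondensation.Cruxes.StaticResponseBound.FewBody5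

open MeasureTheory Filter
open scoped ENNReal NNReal BigOperators Topology
open Literature.MathematicalPhysics.QuantumManyBody.BoseGas
open Summit.AtomisticToContinuum.BoseEinsteinCondensation.Theses
open Summit.AtomisticToContinuum.BoseEinsteinCondensation.Theses.BECInsertionCorrector
open Summit.AtomisticToContinuum.BoseEinsteinCondensation.Theorems.StaticResponseBound.Negative
open Summit.AtomisticToContinuum.BoseEinsteinCondensation.Cruxes.StaticResponseBound.UvThomsonForceWave
open Summit.AtomisticToContinuum.BoseEinsteinCondensation.Cruxes.StaticResponseBound.FewBody

variable {N : ℕ} {L : ℝ}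

section Main

variable {w : ℝ → ℝ≥0∞} {Φ : PeriodicTrialState N L}

/-- **Registered stub `stub_allCouplingPT` (seat a1): second-order perturbation theory for one real component,
valid for EVERY coupling `t`.**  `Φ > 0` a real finite-energy minimiser of `E_w` among finite-energy periodic states
(value `λ`), weighted gap `((2π/L)² − 2λ)∫η²F² ≤ 𝓔_F(η)` on `F²`-mean-zero symmetric tests, sign `t⟨V⟩_Φ ≥ 0`,
few-body condition `5λ ≤ (2π/L)²`; then for every real `C¹` lattice-periodic Bose-symmetric `θ`:
`𝓔_F(θ) + t∫Vθ²F² ≥ −14 t² (N/|p|²) ∫θ²F²`.  See the file header for the proof.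
[cite: ReedSimonIV1978, §XII.2; Davies1989, §4.2] -/
theorem stub_allCouplingPT :
    ∀ (w : ℝ → ℝ≥0∞) (N : ℕ) (L : ℝ), 0 < L → Measurable w →
      ∀ Φ : PeriodicTrialState N L, (∀ X, Φ.ψ X = (‖Φ.ψ X‖ : ℂ)) → (∀ X, Φ.ψ X ≠ 0) →
        periodicEnergy w Φ ≠ ⊤ →
        (∀ Ψ : PeriodicTrialState N L, periodicEnergy w Ψ ≠ ⊤ →
          (periodicEnergy w Φ).toReal ≤ (periodicEnergy w Ψ).toReal) →
        ∀ (k : Fin 3 → ℤ), k ≠ 0 → 0 < N → ∀ t : ℝ,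
        (∀ η : Config N → ℝ, IsPeriodicTest L η →
          (∀ (σ : Equiv.Perm (Fin N)) (X : Config N), η (X ∘ σ) = η X) →
          (∫ X in cellN N L, η X * ‖Φ.ψ X‖ ^ 2) = 0 →
          ((2 * Real.pi / L) ^ 2 - 2 * (periodicEnergy w Φ).toReal) *
              ∫ X in cellN N L, η X ^ 2 * ‖Φ.ψ X‖ ^ 2 ≤ dirichletFormW L (fun X => ‖Φ.ψ X‖) η η) →
        0 ≤ t * cosMean L k Φ →
        5 * (periodicEnergy w Φ).toReal ≤ (2 * Real.pi / L) ^ 2 →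
        ∀ θ : Config N → ℝ, IsPeriodicTest L θ →
          (∀ (σ : Equiv.Perm (Fin N)) (X : Config N), θ (X ∘ σ) = θ X) →
          -(14 * t ^ 2 * N / psq L k) * ∫ X in cellN N L, θ X ^ 2 * ‖Φ.ψ X‖ ^ 2 ≤
            dirichletFormW L (fun X => ‖Φ.ψ X‖) θ θ +
              t * ∫ X in cellN N L,
                (∑ j, Real.cos (2 * Real.pi / L * ∑ i, (k i : ℝ) * X j i)) * θ X ^ 2 * ‖Φ.ψ X‖ ^ 2 := by
  intro w N L hL hw Φ hreal hpos hfin hmin k hk hN t hgap hsign hlam θ hθ hθsymm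
  have hP : 0 < psq L k := freeSq_psq_pos hL hk
  have hNr : (0 : ℝ) < N := by exact_mod_cast hN
  have hFt : IsPeriodicTest L fun X => ‖Φ.ψ X‖ := pt5_isPeriodicTest_norm Φ hreal
  have hF : ContDiff ℝ 1 fun X => ‖Φ.ψ X‖ := hFt.1
  have hFc : Continuous fun X => ‖Φ.ψ X‖ := hF.continuous
  have hF2c : Continuous fun X => ‖Φ.ψ X‖ ^ 2 := hFc.pow 2
  have hθc : Continuous θ := hθ.continuous
  set lam : ℝ := (periodicEnergy w Φ).toReal with hlamdef
  -- the centred component `η = θ - a`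
  set a : ℝ := ∫ Y in cellN N L, θ Y * ‖Φ.ψ Y‖ ^ 2 with ha
  set η : Config N → ℝ := fun X => θ X - a with hηdef
  have hη : IsPeriodicTest L η := hθ.sub (IsPeriodicTest.const L a)
  have hηc : Continuous η := hη.continuous
  have hηsymm : ∀ (σ : Equiv.Perm (Fin N)) (X : Config N), η (X ∘ σ) = η X := fun σ X => by
    simp only [hηdef, hθsymm σ X]
  have iθF : IntegrableOn (fun X => θ X * ‖Φ.ψ X‖ ^ 2) (cellN N L) := integrableOn_cellN (hθc.mul hF2c) L
  have iF : IntegrableOn (fun X => ‖Φ.ψ X‖ ^ 2) (cellN N L) := integrableOn_cellN hF2c L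
  have hη0 : ∫ X in cellN N L, η X * ‖Φ.ψ X‖ ^ 2 = 0 := by
    have hexp : ∀ X, η X * ‖Φ.ψ X‖ ^ 2 = θ X * ‖Φ.ψ X‖ ^ 2 - a * ‖Φ.ψ X‖ ^ 2 := fun X => by
      simp only [hηdef]; ring
    simp_rw [hexp]
    rw [integral_sub iθF (iF.const_mul a), integral_const_mul, integral_norm_sq_eq_one Φ, ← ha]
    ring
  -- the quantities of the algebraic core
  set D : ℝ := dirichletFormW L (fun X => ‖Φ.ψ X‖) η η with hDdef
  set m : ℝ := ∫ X in cellN N L, η X ^ 2 * ‖Φ.ψ X‖ ^ 2 with hmdef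
  set S : ℝ := cosMean L k Φ with hSdef
  set T₀ : ℝ := ∫ X in cellN N L, gradDot (fun Y => ‖Φ.ψ Y‖) (fun Y => ‖Φ.ψ Y‖) X with hT₀def
  set g : ℝ := (2 * Real.pi / L) ^ 2 - 2 * lam with hgdef
  set Z : ℝ := Real.sqrt (∫ X in cellN N L,
    η X ^ 2 * gradDot (fun Y => ‖Φ.ψ Y‖) (fun Y => ‖Φ.ψ Y‖) X) with hZdef
  have hD : 0 ≤ D := dirichletFormW_self_nonneg L _ η
  have hm : 0 ≤ m := setIntegral_nonneg (measurableSet_cellN N L) fun X _ => by positivity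
  have hgapη : g * m ≤ D := hgap η hη hηsymm hη0
  -- `T₀ ≤ λ`
  have hT0 : 0 ≤ T₀ := setIntegral_nonneg (measurableSet_cellN N L) fun X _ => gradDot_self_nonneg _ X
  have hΦ1 : ∀ X, Φ.ψ X = (((1 : ℝ) * ‖Φ.ψ X‖ : ℝ) : ℂ) := fun X => by rw [one_mul]; exact hreal X
  have hT0lam : T₀ ≤ lam := by
    have h := toReal_periodicEnergy_of_eq_mul hw hreal hpos hfin Φ contDiff_const hΦ1
    simp only [one_mul] at h
    rw [hlamdef, h]
    have : 0 ≤ ∫ X in cellN N L, (periodicInteraction w L X).toReal * ‖Φ.ψ X‖ ^ 2 :=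
      setIntegral_nonneg (measurableSet_cellN N L) fun X _ =>
        mul_nonneg ENNReal.toReal_nonneg (sq_nonneg _)
    linarith
  have hlam3 : 3 * lam ≤ g := by rw [hgdef]; linarith
  -- the Euler–Lagrange bound
  have hZ0 : 0 ≤ ∫ X in cellN N L, η X ^ 2 * gradDot (fun Y => ‖Φ.ψ Y‖) (fun Y => ‖Φ.ψ Y‖) X :=
    setIntegral_nonneg (measurableSet_cellN N L) fun X _ => mul_nonneg (sq_nonneg _) (gradDot_self_nonneg _ X)
  have hZ2 : Z ^ 2 ≤ lam * m + 2 * Real.sqrt D * Z := by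
    rw [hZdef, Real.sq_sqrt hZ0]
    exact pt5_eulerLagrange_sq_bound hL hw hreal hpos hfin hmin hη hηsymm
  -- the weighted square (`κ = 1/4`) and the mean flux identity
  have hWS := pt5_weightedSq_sum hL hk hFt hθ
    (Θ := fun j X => 2 * Real.pi / L * ∑ i, (k i : ℝ) * X j i) (fun _ _ => rfl)
    (p := fun c => 2 * Real.pi / L * k c) (fun _ => rfl) (κ := 1 / 4) (by norm_num) t
  have hMF := pt5_meanFlux hL hFt
    (Θ := fun j X => 2 * Real.pi / L * ∑ i, (k i : ℝ) * X j i) (fun _ _ => rfl)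
    (p := fun c => 2 * Real.pi / L * k c) (fun _ => rfl)
  have hS' : (∫ X in cellN N L, (∑ j, Real.cos (2 * Real.pi / L * ∑ i, (k i : ℝ) * X j i)) * ‖Φ.ψ X‖ ^ 2) = S :=
    rfl
  rw [hS'] at hMF
  -- the force field `B` and the named integrals
  set B : Config N → ℝ := fun X => ∑ j, Real.sin (2 * Real.pi / L * ∑ i, (k i : ℝ) * X j i) *
    ∑ c, 2 * Real.pi / L * (k c : ℝ) * pderiv j c (fun Y => ‖Φ.ψ Y‖) X with hBdef
  have hBx : ∀ X, (∑ j, Real.sin (2 * Real.pi / L * ∑ i, (k i : ℝ) * X j i) *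
      ∑ c, 2 * Real.pi / L * (k c : ℝ) * pderiv j c (fun Y => ‖Φ.ψ Y‖) X) = B X := fun X => rfl
  simp_rw [hBx] at hWS hMF
  have hBc : Continuous B := by
    rw [hBdef]
    exact continuous_finsetSum _ fun j _ => (by fun_prop : Continuous fun X : Config N =>
      Real.sin (2 * Real.pi / L * ∑ i, (k i : ℝ) * X j i)).mul
        (continuous_finsetSum _ fun c _ => continuous_const.mul (continuous_pderiv hF j c))
  set SB : ℝ := ∫ X in cellN N L, B X * ‖Φ.ψ X‖ with hSBdef
  set P₂ : ℝ := ∫ X in cellN N L, B X * (η X * ‖Φ.ψ X‖) with hP₂def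
  set P₃ : ℝ := ∫ X in cellN N L, B X * (η X ^ 2 * ‖Φ.ψ X‖) with hP₃def
  set X₄ : ℝ := ∫ X in cellN N L, B X * (θ X ^ 2 * ‖Φ.ψ X‖) with hX₄def
  set I : ℝ := ∫ X in cellN N L,
    (∑ j, Real.cos (2 * Real.pi / L * ∑ i, (k i : ℝ) * X j i)) * θ X ^ 2 * ‖Φ.ψ X‖ ^ 2 with hIdef
  set Mθ : ℝ := ∫ X in cellN N L, θ X ^ 2 * ‖Φ.ψ X‖ ^ 2 with hMθdef
  -- decomposition of the cross term `X₄ = a² SB + 2a P₂ + P₃`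
  have iB1 : Integrable (fun X => B X * ‖Φ.ψ X‖) (volume.restrict (cellN N L)) :=
    integrableOn_cellN (hBc.mul hFc) L
  have iB2 : Integrable (fun X => B X * (η X * ‖Φ.ψ X‖)) (volume.restrict (cellN N L)) :=
    integrableOn_cellN (hBc.mul (hηc.mul hFc)) L
  have iB3 : Integrable (fun X => B X * (η X ^ 2 * ‖Φ.ψ X‖)) (volume.restrict (cellN N L)) :=
    integrableOn_cellN (hBc.mul ((hηc.pow 2).mul hFc)) L
  have hX4 : X₄ = a ^ 2 * SB + 2 * a * P₂ + P₃ := by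
    have hexp : ∀ X, B X * (θ X ^ 2 * ‖Φ.ψ X‖) =
        a ^ 2 * (B X * ‖Φ.ψ X‖) + 2 * a * (B X * (η X * ‖Φ.ψ X‖)) + B X * (η X ^ 2 * ‖Φ.ψ X‖) := by
      intro X; simp only [hηdef]; ring
    rw [hX₄def]
    simp_rw [hexp]
    have i12 : Integrable (fun X => a ^ 2 * (B X * ‖Φ.ψ X‖) + 2 * a * (B X * (η X * ‖Φ.ψ X‖)))
        (volume.restrict (cellN N L)) := (iB1.const_mul _).add (iB2.const_mul _)
    rw [integral_add i12 iB3, integral_add (iB1.const_mul _) (iB2.const_mul _), integral_const_mul,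
      integral_const_mul]
  have hSB : SB = -(psq L k * S) / 2 := by linarith
  -- `𝓔(θ) = D` and `∫ θ²F² = a² + m`
  have hDθ : dirichletFormW L (fun X => ‖Φ.ψ X‖) θ θ = D := by
    rw [hDdef]
    unfold dirichletFormW
    refine integral_congr_ae (ae_of_all _ fun X => ?_)
    simp only [hηdef, gradDot_sub_const]
  have hmθ : m = Mθ - a ^ 2 := by
    rw [hmdef]
    exact integral_sub_mean_sq_mul Φ hreal hθc
  -- the bounds on `P₂` and `P₃`
  have hF0 : ∀ X, 0 ≤ ‖Φ.ψ X‖ := fun X => norm_nonneg _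
  have hBsq : ∀ X, B X ^ 2 ≤ N * psq L k * gradDot (fun Y => ‖Φ.ψ Y‖) (fun Y => ‖Φ.ψ Y‖) X := fun X =>
    pt5_forceField_sq_le (fun Y => ‖Φ.ψ Y‖) (fun j X => 2 * Real.pi / L * ∑ i, (k i : ℝ) * X j i)
      (p := fun c => 2 * Real.pi / L * k c) (fun _ => rfl) X
  have hgFF : Continuous (gradDot (fun Y => ‖Φ.ψ Y‖) (fun Y => ‖Φ.ψ Y‖)) := continuous_gradDot hF hF
  have hP2 : |P₂| ≤ Real.sqrt m * Real.sqrt (psq L k * N * T₀) := by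
    have h1 : P₂ = ∫ X in cellN N L, (η X * ‖Φ.ψ X‖) * B X := by
      rw [hP₂def]; exact integral_congr_ae (ae_of_all _ fun X => by dsimp only; ring)
    have hφc : Continuous fun X => η X * ‖Φ.ψ X‖ := hηc.mul hFc
    have h2 := pt5_abs_integral_mul_le hφc hBc L
    have e1 : (∫ X in cellN N L, (η X * ‖Φ.ψ X‖) ^ 2) = m := by
      rw [hmdef]; exact integral_congr_ae (ae_of_all _ fun X => by dsimp only; ring)
    have h3 : (∫ X in cellN N L, B X ^ 2) ≤ psq L k * N * T₀ := by
      have iL : Integrable (fun X => B X ^ 2) (volume.restrict (cellN N L)) := integrableOn_cellN (hBc.pow 2) L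
      have iR : Integrable (fun X => (N * psq L k) * gradDot (fun Y => ‖Φ.ψ Y‖) (fun Y => ‖Φ.ψ Y‖) X)
          (volume.restrict (cellN N L)) := (integrableOn_cellN hgFF L).const_mul ((N : ℝ) * psq L k)
      have h := integral_mono iL iR hBsq
      rw [integral_const_mul] at h
      calc (∫ X in cellN N L, B X ^ 2) ≤ N * psq L k * T₀ := h
        _ = psq L k * N * T₀ := by ring
    rw [h1]
    rw [e1] at h2
    exact h2.trans (mul_le_mul_of_nonneg_left (Real.sqrt_le_sqrt h3) (Real.sqrt_nonneg m))
  have hP3 : |P₃| ≤ Real.sqrt m * Real.sqrt (psq L k * N) * Z := by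
    have h1 : P₃ = ∫ X in cellN N L, (η X * ‖Φ.ψ X‖) * (η X * B X) := by
      rw [hP₃def]; exact integral_congr_ae (ae_of_all _ fun X => by dsimp only; ring)
    have hφc : Continuous fun X => η X * ‖Φ.ψ X‖ := hηc.mul hFc
    have hψc : Continuous fun X => η X * B X := hηc.mul hBc
    have h2 := pt5_abs_integral_mul_le hφc hψc L
    have e1 : (∫ X in cellN N L, (η X * ‖Φ.ψ X‖) ^ 2) = m := by
      rw [hmdef]; exact integral_congr_ae (ae_of_all _ fun X => by dsimp only; ring)
    have h3 : (∫ X in cellN N L, (η X * B X) ^ 2) ≤ psq L k * N *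
        ∫ X in cellN N L, η X ^ 2 * gradDot (fun Y => ‖Φ.ψ Y‖) (fun Y => ‖Φ.ψ Y‖) X := by
      have hpt : ∀ X, (η X * B X) ^ 2 ≤
          (N * psq L k) * (η X ^ 2 * gradDot (fun Y => ‖Φ.ψ Y‖) (fun Y => ‖Φ.ψ Y‖) X) := by
        intro X
        rw [mul_pow]
        calc η X ^ 2 * B X ^ 2 ≤ η X ^ 2 * (N * psq L k * gradDot (fun Y => ‖Φ.ψ Y‖) (fun Y => ‖Φ.ψ Y‖) X) :=
              mul_le_mul_of_nonneg_left (hBsq X) (sq_nonneg _)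
          _ = _ := by ring
      have iL : Integrable (fun X => (η X * B X) ^ 2) (volume.restrict (cellN N L)) :=
        integrableOn_cellN (hψc.pow 2) L
      have iR : Integrable (fun X => (N * psq L k) *
          (η X ^ 2 * gradDot (fun Y => ‖Φ.ψ Y‖) (fun Y => ‖Φ.ψ Y‖) X)) (volume.restrict (cellN N L)) :=
        (integrableOn_cellN ((hηc.pow 2).mul hgFF) L).const_mul ((N : ℝ) * psq L k)
      have h := integral_mono iL iR hpt
      rw [integral_const_mul] at h
      calc (∫ X in cellN N L, (η X * B X) ^ 2)
          ≤ N * psq L k * ∫ X in cellN N L, η X ^ 2 * gradDot (fun Y => ‖Φ.ψ Y‖) (fun Y => ‖Φ.ψ Y‖) X := h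
        _ = _ := by ring
    have h4 : Real.sqrt (∫ X in cellN N L, (η X * B X) ^ 2) ≤ Real.sqrt (psq L k * N) * Z := by
      rw [hZdef, ← Real.sqrt_mul (by positivity)]
      exact Real.sqrt_le_sqrt h3
    rw [h1]
    rw [e1] at h2
    calc |∫ X in cellN N L, (η X * ‖Φ.ψ X‖) * (η X * B X)|
        ≤ Real.sqrt m * Real.sqrt (∫ X in cellN N L, (η X * B X) ^ 2) := h2
      _ ≤ Real.sqrt m * (Real.sqrt (psq L k * N) * Z) := mul_le_mul_of_nonneg_left h4 (Real.sqrt_nonneg m)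
      _ = _ := by ring
  -- the weighted square in the form of the algebraic core
  have hI : -(4 * t ^ 2 * N / psq L k) * (a ^ 2 + m) + t * a ^ 2 * S
      - (2 * t / psq L k) * (2 * a * P₂ + P₃) ≤ D / 4 + t * I := by
    rw [hDθ, hX4, hSB] at hWS
    have e1 : t ^ 2 * N / (1 / 4 * psq L k) * Mθ = (4 * t ^ 2 * N / psq L k) * (a ^ 2 + m) := by
      rw [hmθ]; field_simp; ring
    have e2 : 2 * t / psq L k * (a ^ 2 * (-(psq L k * S) / 2) + 2 * a * P₂ + P₃) =
        -(t * a ^ 2 * S) + (2 * t / psq L k) * (2 * a * P₂ + P₃) := by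
      field_simp; ring
    rw [e1, e2] at hWS
    linarith
  -- the algebraic core
  have hcore := allCoupling_algebraic_core (a := a) hD hm hgapη hP hNr hT0 hT0lam hlam3 hsign hZ2 hP2 hP3 hI
  rw [hDθ]
  have e3 : Mθ = a ^ 2 + m := by linarith
  rw [e3]
  exact hcore

end Main

end Summit.AtomisticToContinuum.BoseEinsteinCondensation.Cruxes.StaticResponseBound.FewBody5

end
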